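import Mathlib.Algebra.Module.ZLattice.Summable
import Literature.NumberTheory.Automorphic.AdeleQuotientFourierDecay
import HarnessLib

/-!
# Absolute summability of the Fourier coefficients of smooth functions on `𝔸_K ⧸ K`
(the analytic input of the Fourier–Whittaker expansion of smooth cusp forms, Cogdell (2004), §1.1,
Thm. 1.1; Moeglin–Waldspurger (1995), proof of Lemma I.2.10)

Topic `NumberTheory/Automorphic`; sequel to `AdeleQuotientFourierDecay`. For a continuous function
`f` on `𝔸_K ⧸ K` write `f̂(ξ) = ∫ conj ψ_ξ · f` (`ψ_ξ = adeleQuotChar K ξ`, `ξ ∈ K`). We PROVE: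

* `exists_eq_mul_of_integral_conj_adeleQuotChar_mul_ne_zero` — **finite level bounds the
  support**: if `f` is invariant under the translations by the archimedean images `((c r)_∞, 0)`
  of the lattice `c 𝓞_K` (`c ∈ 𝓞_K`; on `𝔸_K ⧸ K` these are the translations by the finite
  integral adeles `(0, (c r)_f)`, i.e. invariance under a compact open subgroup of `𝔸_K^∞`), then
  `f̂(ξ) ≠ 0` forces `Tr_{K/ℚ}(ξ c r) ∈ ℤ` for all `r ∈ 𝓞_K`, i.e. `c ξ` lies in the codifferent, so
  `D c ξ ∈ 𝓞_K` for the common denominator `D` of `exists_denominator_codifferent`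
  (`AdelicAdditiveCharacterDuality`).
* `summable_norm_integral_conj_adeleQuotChar_mul` — **smoothness gives absolute summability**:
  if moreover `f` admits, along every archimedean line `s ↦ u + (s v, 0)`, a chain of `k`
  successive derivatives which are continuous functions on `𝔸_K ⧸ K`, with `k > [K : ℚ]`, then
  `∑_{ξ ∈ K} |f̂(ξ)| < ∞`: by `AdeleQuotientFourierDecay`, `|f̂(ξ)| (2π |Tr(ξ v)|)^k ≤ sup |f_k^{(v)}|`
  for each of the finitely many coordinate directions `v`, and `max_v |Tr(ξ v)| ≫ ‖ξ‖_∞`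
  (`norm_le_sum_abs_mixedTrace_mul`), so `|f̂(ξ)| ≪ ‖D c ξ‖_∞^{-k}` on the support, which is summable
  over the lattice `D c ξ ∈ 𝓞_K ↪ ℝ^{r₁} × ℂ^{r₂}` (Mathlib `ZLattice.summable_norm_pow_inv` for
  `mixedEmbedding.integerLattice K`).

With `AdeleQuotientFourierInversion.eq_tsum_integral_mul_adeleQuotChar` this yields the pointwise,
absolutely convergent Fourier expansion of such `f` — the one-variable Fourier analysis behind the
Whittaker expansion of cusp forms on `GL_2` (Cogdell (2004), §1.1) and behind MW's Lemma I.2.10.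
Everything here is proved; [folklore].

## References

* J. W. Cogdell, *Analytic theory of L-functions for GL_n*, in: J. Bernstein, S. Gelbart (eds.),
  *An Introduction to the Langlands Program* (2004), §1.1, Thm. 1.1 [CogdellAnalyticTheory2004].
* C. Moeglin, J.-L. Waldspurger, *Spectral decomposition and Eisenstein series*, Cambridge Tracts
  in Math. 113 (1995), proof of Lemma I.2.10 [MoeglinWaldspurger1995].
* J. Tate, in Cassels–Fröhlich (eds.), *Algebraic Number Theory* (1967), Ch. XV, §4.1
  [CasselsFrohlichANT1967].
-/

noncomputable section

open _root_.MeasureTheory _root_.MeasureTheory.Measure Set Filter IsDedekindDomain NumberField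
open NumberField.mixedEmbedding NumberField.InfinitePlace
open _root_.Topology
open scoped ENNReal ComplexConjugate Real

namespace Literature.NumberTheory.Automorphic

variable (K : Type) [Field K] [NumberField K]
  [MeasurableSpace (adeleQuotient K)] [BorelSpace (adeleQuotient K)]

/-! ### Finite level bounds the support of the Fourier coefficients -/

omit [MeasurableSpace (adeleQuotient K)] [BorelSpace (adeleQuotient K)] in
/-- `ψ_ξ` at the archimedean image of a principal adele: `ψ_ξ((a_∞, 0) + K) = exp(-2πi Tr_{K/ℚ}(ξ a))`.
[folklore] -/
theorem coe_adeleQuotChar_mk_infiniteAdeleInl_algebraMap (ξ a : K) :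
    (adeleQuotChar K ξ (QuotientAddGroup.mk
      (infiniteAdeleInl K (algebraMap K (InfiniteAdeleRing K) a))) : ℂ) =
      Complex.exp (((-(2 * π * Algebra.trace ℚ K (ξ * a)) : ℝ) : ℂ) * Complex.I) := by
  rw [coe_adeleQuotChar_mk_infiniteAdeleInl, ← InfiniteAdeleRing.mixedEmbedding_eq_algebraMap_comp,
    ← map_mul, mixedTrace_mixedEmbedding]

/-- **Finite level bounds the support of the Fourier coefficients.** Let `f : 𝔸_K ⧸ K → ℂ` be
invariant under translation by the archimedean images `((c r)_∞, 0) + K`, `r ∈ 𝓞_K`, of the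
lattice `c 𝓞_K` (equivalently, by the finite integral adeles `(0, (c r)_f) + K`). If `f̂(ξ) ≠ 0`
then `D c ξ ∈ 𝓞_K`, where `D` is a common denominator of the codifferent
(`exists_denominator_codifferent`): by translation covariance `f̂(ξ) = ψ_ξ((c r)_∞, 0) f̂(ξ)`, so
`exp(-2πi Tr(ξ c r)) = 1`, i.e. `Tr_{K/ℚ}(ξ c r) ∈ ℤ` for all `r ∈ 𝓞_K` — `c ξ` lies in the
codifferent `(𝓞_K)^∨`. (Garrett (2018), proof of Thm. 7.3.10: "Thus `ξ ∈ (1/h) 𝔫_𝔬`".)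
[folklore] -/
theorem exists_eq_mul_of_integral_conj_adeleQuotChar_mul_ne_zero {D : 𝓞 K}
    (hD : ∀ k : K, (∀ u : 𝓞 K, ∃ n : ℤ, (n : ℚ) = Algebra.trace ℚ K ((u : K) * k)) →
      ∃ r : 𝓞 K, (r : K) = (D : K) * k)
    (f : adeleQuotient K → ℂ) (c : 𝓞 K)
    (hinv : ∀ (r : 𝓞 K) (u : adeleQuotient K), f (u + QuotientAddGroup.mk
      (infiniteAdeleInl K (algebraMap K (InfiniteAdeleRing K) ((c : K) * r)))) = f u)
    {ξ : K} (hξ : ∫ u, conj (adeleQuotChar K ξ u : ℂ) * f u ∂(adeleQuotHaar K) ≠ 0) :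
    ∃ r : 𝓞 K, (r : K) = (D : K) * ((c : K) * ξ) := by
  refine hD ((c : K) * ξ) fun r => ?_
  -- translation covariance at `w = ((c r)_∞, 0) + K`
  set w : adeleQuotient K := QuotientAddGroup.mk
    (infiniteAdeleInl K (algebraMap K (InfiniteAdeleRing K) ((c : K) * r))) with hw
  have hcov := integral_conj_adeleQuotChar_mul_comp_add K f ξ w
  have hinv' : ∀ u, f (u + w) = f u := fun u => hinv r u
  simp only [hinv'] at hcov
  have hone : (adeleQuotChar K ξ w : ℂ) = 1 := (mul_eq_right₀ hξ).1 hcov.symm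
  rw [hw, coe_adeleQuotChar_mk_infiniteAdeleInl_algebraMap, Complex.exp_eq_one_iff] at hone
  obtain ⟨n, hn⟩ := hone
  refine ⟨-n, ?_⟩
  have h1 : ((-(2 * π * Algebra.trace ℚ K (ξ * ((c : K) * r))) : ℝ) : ℂ) =
      (((n : ℝ) * (2 * π) : ℝ) : ℂ) := by
    apply mul_right_cancel₀ Complex.I_ne_zero
    rw [hn]
    push_cast
    ring
  have h2 : -(2 * π * (Algebra.trace ℚ K (ξ * ((c : K) * r)) : ℝ)) = (n : ℝ) * (2 * π) :=
    Complex.ofReal_injective h1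
  have h3 : ((Algebra.trace ℚ K (ξ * ((c : K) * r)) : ℚ) : ℝ) = ((-n : ℤ) : ℚ) := by
    push_cast
    nlinarith [Real.pi_pos]
  have h4 : (Algebra.trace ℚ K (ξ * ((c : K) * r)) : ℚ) = ((-n : ℤ) : ℚ) := by exact_mod_cast h3
  rw [← h4]
  congr 1
  ring

/-! ### Smoothness gives absolute summability -/

omit [MeasurableSpace (adeleQuotient K)] [BorelSpace (adeleQuotient K)] in
open scoped Classical in
/-- `∑_{r ∈ 𝓞_K} ‖r‖_∞^{-k} < ∞` for `k > [K : ℚ]`, `‖·‖_∞` the sup norm of `ℝ^{r₁} × ℂ^{r₂}` under the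
mixed embedding (Mathlib `ZLattice.summable_norm_pow_inv` for the lattice
`mixedEmbedding.integerLattice K`, of rank `[K : ℚ]`). [folklore] -/
theorem summable_norm_mixedEmbedding_inv_pow {k : ℕ} (hk : Module.finrank ℚ K < k) :
    Summable fun r : 𝓞 K => ‖mixedEmbedding K (r : K)‖⁻¹ ^ k := by
  have h : Summable fun z : mixedEmbedding.integerLattice K => ‖z‖⁻¹ ^ k := by
    refine ZLattice.summable_norm_pow_inv (mixedEmbedding.integerLattice K) k ?_
    rw [ZLattice.rank ℝ (mixedEmbedding.integerLattice K), mixedEmbedding.finrank]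
    exact hk
  have hmem : ∀ r : 𝓞 K, mixedEmbedding K (r : K) ∈ mixedEmbedding.integerLattice K :=
    fun r => ⟨r, rfl⟩
  have hinj : Function.Injective fun r : 𝓞 K =>
      (⟨mixedEmbedding K (r : K), hmem r⟩ : mixedEmbedding.integerLattice K) := fun r r' hh =>
    RingOfIntegers.coe_injective (mixedEmbedding_injective K (congrArg Subtype.val hh))
  refine (h.comp_injective hinj).congr fun r => ?_
  rfl

open scoped Classical in
/-- **Smooth functions on `𝔸_K ⧸ K` have absolutely summable Fourier coefficients.** Let
`f : 𝔸_K ⧸ K → ℂ` be continuous, invariant under the translations `((c r)_∞, 0) + K`, `r ∈ 𝓞_K`,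
for some `c ∈ 𝓞_K ∖ 0` (finite level), and suppose that along every archimedean line
`s ↦ u + (s v, 0) + K` (`v ∈ K_∞ ≅ mixedSpace K`) there is a chain `f = f₀, f₁, …, f_k` of
continuous functions on `𝔸_K ⧸ K`, each the `s`-derivative of the previous one, with `k > [K : ℚ]`
(archimedean smoothness). Then `∑_{ξ ∈ K} |f̂(ξ)| < ∞`. Proof: `f̂` is supported on
`{ξ : D c ξ ∈ 𝓞_K}` (`exists_eq_mul_of_integral_conj_adeleQuotChar_mul_ne_zero`); for such `ξ ≠ 0`,
`|f̂(ξ)| (2π |Tr(ξ v)|)^k ≤ M` for the coordinate directions `v`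
(`norm_integral_conj_adeleQuotChar_mul_mul_pow_le`) and `‖ξ‖_∞ ≤ N max_v |Tr(ξ v)|`
(`norm_le_sum_abs_mixedTrace_mul`), whence `|f̂(ξ)| ≤ C ‖D c ξ‖_∞^{-k}`, summable over
`D c ξ ∈ 𝓞_K` (`summable_norm_mixedEmbedding_inv_pow`). This is the integration-by-parts estimate
of the Fourier–Whittaker expansion (Cogdell (2004), §1.1; Moeglin–Waldspurger (1995), proof of
Lemma I.2.10). [cite: CogdellAnalyticTheory2004, §1.1] -/
theorem summable_norm_integral_conj_adeleQuotChar_mul {f : adeleQuotient K → ℂ}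
    {c : 𝓞 K} (hc : c ≠ 0)
    (hinv : ∀ (r : 𝓞 K) (u : adeleQuotient K), f (u + QuotientAddGroup.mk
      (infiniteAdeleInl K (algebraMap K (InfiniteAdeleRing K) ((c : K) * r)))) = f u)
    {k : ℕ} (hk : Module.finrank ℚ K < k)
    (hder : ∀ v : mixedSpace K, ∃ g : ℕ → adeleQuotient K → ℂ, g 0 = f ∧
      (∀ j ≤ k, Continuous (g j)) ∧
      ∀ j < k, ∀ (u : adeleQuotient K) (s : ℝ), HasDerivAt
        (fun s : ℝ => g j (u + QuotientAddGroup.mk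
          (infiniteAdeleInl K ((InfiniteAdeleRing.ringEquiv_mixedSpace K).symm (s • v)))))
        (g (j + 1) (u + QuotientAddGroup.mk
          (infiniteAdeleInl K ((InfiniteAdeleRing.ringEquiv_mixedSpace K).symm (s • v))))) s) :
    Summable fun ξ : K => ‖∫ u, conj (adeleQuotChar K ξ u : ℂ) * f u ∂(adeleQuotHaar K)‖ := by
  -- notation for the coefficients
  obtain ⟨F, hF⟩ : ∃ F : K → ℂ,
      F = fun ξ => ∫ u, conj (adeleQuotChar K ξ u : ℂ) * f u ∂(adeleQuotHaar K) := ⟨_, rfl⟩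
  rw [show (fun ξ : K => ‖∫ u, conj (adeleQuotChar K ξ u : ℂ) * f u ∂(adeleQuotHaar K)‖) =
    fun ξ => ‖F ξ‖ from by rw [hF]]
  -- the denominator of the codifferent and the support
  obtain ⟨D, hD0, hD⟩ := exists_denominator_codifferent K
  obtain ⟨d, hd⟩ : ∃ d : K, d = (D : K) * (c : K) := ⟨_, rfl⟩
  have hd0 : d ≠ 0 := by
    rw [hd]
    exact mul_ne_zero (by exact_mod_cast hD0) (by exact_mod_cast hc)
  have hsupp : ∀ ξ : K, F ξ ≠ 0 → ∃ r : 𝓞 K, (r : K) = d * ξ := fun ξ hξ => by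
    obtain ⟨r, hr⟩ := exists_eq_mul_of_integral_conj_adeleQuotChar_mul_ne_zero K hD f c hinv
      (ξ := ξ) (by rwa [hF] at hξ)
    exact ⟨r, by rw [hr, hd, mul_assoc]⟩
  -- the coordinate directions
  obtain ⟨dir, hdir⟩ : ∃ dir : ({w : InfinitePlace K // w.IsReal} ⊕
      ({w : InfinitePlace K // w.IsComplex} × Bool)) → mixedSpace K, dir = fun i => match i with
    | Sum.inl w => ((Pi.single w 1, 0) : mixedSpace K)
    | Sum.inr (w, false) => ((0, Pi.single w 1) : mixedSpace K)
    | Sum.inr (w, true) => ((0, Pi.single w Complex.I) : mixedSpace K) := ⟨_, rfl⟩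
  haveI : Nonempty ({w : InfinitePlace K // w.IsReal} ⊕
      ({w : InfinitePlace K // w.IsComplex} × Bool)) := by
    obtain ⟨w⟩ := (inferInstance : Nonempty (InfinitePlace K))
    rcases w.isReal_or_isComplex with hw | hw
    · exact ⟨Sum.inl ⟨w, hw⟩⟩
    · exact ⟨Sum.inr (⟨w, hw⟩, false)⟩
  obtain ⟨N, hN⟩ : ∃ N : ℕ, N = Fintype.card ({w : InfinitePlace K // w.IsReal} ⊕
      ({w : InfinitePlace K // w.IsComplex} × Bool)) := ⟨_, rfl⟩
  have hN0 : 0 < (N : ℝ) := by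
    rw [hN]
    exact_mod_cast Fintype.card_pos
  -- the trace functionals of the directions see the sup norm
  have htrace : ∀ x : mixedSpace K, ‖x‖ ≤ ∑ i, |mixedTrace K (x * dir i)| := fun x => by
    refine (norm_le_sum_abs_mixedTrace_mul K x).trans (le_of_eq ?_)
    rw [Fintype.sum_sum_type, Fintype.sum_prod_type]
    simp only [hdir, Fintype.sum_bool, add_comm]
  -- the derivative chains along the directions, and a common bound for their ends
  choose g hg0 hgc hgd using hder
  have hbd : ∀ i, ∃ M : ℝ, 0 ≤ M ∧ ∀ u, ‖g (dir i) k u‖ ≤ M := fun i =>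
    exists_forall_norm_le_of_continuous K (hgc (dir i) k le_rfl)
  choose Mi hMi0 hMi using hbd
  obtain ⟨M, hM⟩ : ∃ M : ℝ, M = ∑ i, Mi i := ⟨_, rfl⟩
  have hMiM : ∀ i, Mi i ≤ M := fun i => by
    rw [hM]
    exact Finset.single_le_sum (f := Mi) (fun j _ => hMi0 j) (Finset.mem_univ i)
  have hM0 : 0 ≤ M := by
    rw [hM]
    exact Finset.sum_nonneg fun i _ => hMi0 i
  -- the decay estimate along each direction
  have hdecay : ∀ (ξ : K) (i),
      ‖F ξ‖ * (2 * π * |mixedTrace K (mixedEmbedding K ξ * dir i)|) ^ k ≤ M := fun ξ i => by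
    have h := norm_integral_conj_adeleQuotChar_mul_mul_pow_le K (g (dir i)) k (hgc (dir i)) (dir i)
      (hgd (dir i)) (hMi i) ξ
    rw [hg0 (dir i)] at h
    rw [hF]
    exact h.trans (hMiM i)
  -- the constant of the majorant
  obtain ⟨A, hA⟩ : ∃ A : ℝ, A = ‖mixedEmbedding K d‖ := ⟨_, rfl⟩
  have hA0 : 0 < A := by
    rw [hA]
    exact norm_pos_iff.2 fun h => hd0 ((map_eq_zero_iff _ (mixedEmbedding_injective K)).1 h)
  obtain ⟨C, hC⟩ : ∃ C : ℝ, C = M * (A * N / (2 * π)) ^ k := ⟨_, rfl⟩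
  have hC0 : 0 ≤ C := by
    rw [hC]
    exact mul_nonneg hM0 (pow_nonneg (by positivity) k)
  -- the pointwise bound off `0`
  have hbound : ∀ ξ : K, ξ ≠ 0 → F ξ ≠ 0 → ‖F ξ‖ ≤ C * ‖mixedEmbedding K (d * ξ)‖⁻¹ ^ k := by
    intro ξ hξ0 hFξ
    -- the best direction
    obtain ⟨i₀, -, hi₀⟩ := Finset.exists_max_image Finset.univ
      (fun i => |mixedTrace K (mixedEmbedding K ξ * dir i)|) Finset.univ_nonempty
    obtain ⟨τ, hτ⟩ : ∃ τ : ℝ, τ = |mixedTrace K (mixedEmbedding K ξ * dir i₀)| := ⟨_, rfl⟩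
    have hτ0 : 0 ≤ τ := by rw [hτ]; exact abs_nonneg _
    have hx : ‖mixedEmbedding K ξ‖ ≤ N * τ := by
      refine (htrace _).trans ?_
      calc ∑ i, |mixedTrace K (mixedEmbedding K ξ * dir i)| ≤ ∑ _i, τ :=
            Finset.sum_le_sum fun i _ => by rw [hτ]; exact hi₀ i (Finset.mem_univ i)
        _ = N * τ := by rw [Finset.sum_const, Finset.card_univ, nsmul_eq_mul, hN]
    have hη : ‖mixedEmbedding K (d * ξ)‖ ≤ A * (N * τ) := by
      rw [map_mul, hA]
      exact (norm_mul_le _ _).trans (mul_le_mul_of_nonneg_left hx (norm_nonneg _))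
    have hηpos : 0 < ‖mixedEmbedding K (d * ξ)‖ := norm_pos_iff.2 fun h =>
      mul_ne_zero hd0 hξ0 ((map_eq_zero_iff _ (mixedEmbedding_injective K)).1 h)
    have hτpos : 0 < τ := by
      by_contra h
      have hτz : τ = 0 := le_antisymm (not_lt.1 h) hτ0
      rw [hτz, mul_zero, mul_zero] at hη
      exact absurd hη (not_le.2 hηpos)
    -- from the decay estimate in the best direction
    have h1 : ‖F ξ‖ * (2 * π * τ) ^ k ≤ M := by
      have h := hdecay ξ i₀
      rwa [← hτ] at h
    have h2πτ : 0 < (2 * π * τ) ^ k := pow_pos (by positivity) k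
    have h2 : ‖F ξ‖ ≤ M / (2 * π * τ) ^ k := (le_div_iff₀ h2πτ).2 h1
    refine h2.trans ?_
    -- compare the two majorants
    have h3 : τ⁻¹ ≤ ‖mixedEmbedding K (d * ξ)‖⁻¹ * (A * N) := by
      rw [inv_le_iff_one_le_mul₀ hτpos]
      calc (1 : ℝ) = ‖mixedEmbedding K (d * ξ)‖⁻¹ * ‖mixedEmbedding K (d * ξ)‖ :=
            (inv_mul_cancel₀ hηpos.ne').symm
        _ ≤ ‖mixedEmbedding K (d * ξ)‖⁻¹ * (A * (N * τ)) :=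
            mul_le_mul_of_nonneg_left hη (inv_nonneg.2 hηpos.le)
        _ = ‖mixedEmbedding K (d * ξ)‖⁻¹ * (A * N) * τ := by ring
    have h4 : M / (2 * π * τ) ^ k = M * ((2 * π)⁻¹ * τ⁻¹) ^ k := by
      rw [div_eq_mul_inv, ← inv_pow, mul_inv]
    rw [h4, hC, mul_assoc]
    refine mul_le_mul_of_nonneg_left ?_ hM0
    rw [← mul_pow]
    refine pow_le_pow_left₀ (by positivity) ?_ k
    calc (2 * π)⁻¹ * τ⁻¹ ≤ (2 * π)⁻¹ * (‖mixedEmbedding K (d * ξ)‖⁻¹ * (A * N)) :=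
          mul_le_mul_of_nonneg_left h3 (by positivity)
      _ = A * N / (2 * π) * ‖mixedEmbedding K (d * ξ)‖⁻¹ := by ring
  -- the majorant
  obtain ⟨G, hG⟩ : ∃ G : K → ℝ, G = fun ξ => if ∃ r : 𝓞 K, (r : K) = d * ξ then
    (if ξ = 0 then ‖F 0‖ else C * ‖mixedEmbedding K (d * ξ)‖⁻¹ ^ k) else 0 := ⟨_, rfl⟩
  have hFG : ∀ ξ : K, ‖F ξ‖ ≤ G ξ := fun ξ => by
    rw [hG]
    simp only
    by_cases hFξ : F ξ = 0
    · rw [hFξ, norm_zero]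
      split_ifs with h1 h2
      · exact norm_nonneg _
      · exact mul_nonneg hC0 (pow_nonneg (inv_nonneg.2 (norm_nonneg _)) k)
      · exact le_rfl
    · rw [if_pos (hsupp ξ hFξ)]
      by_cases hξ0 : ξ = 0
      · subst hξ0; rw [if_pos rfl]
      · rw [if_neg hξ0]
        exact hbound ξ hξ0 hFξ
  -- summability of the majorant: reindex by `𝓞_K`
  have hk0 : k ≠ 0 := by omega
  obtain ⟨emb, hemb⟩ : ∃ emb : 𝓞 K → K, emb = fun r : 𝓞 K => (r : K) / d := ⟨_, rfl⟩
  have hdemb : ∀ r, d * emb r = r := fun r => by rw [hemb]; exact mul_div_cancel₀ _ hd0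
  have hembi : Function.Injective emb := fun r r' h => by
    have h' : (r : K) = (r' : K) := by rw [← hdemb r, ← hdemb r', h]
    exact RingOfIntegers.coe_injective h'
  have hemb0 : ∀ r, emb r = 0 ↔ r = 0 := fun r => by
    constructor
    · intro h
      have h1 : (r : K) = 0 := by rw [← hdemb r, h, mul_zero]
      exact RingOfIntegers.coe_injective (by simpa using h1)
    · intro h
      rw [h, hemb]
      simp
  have hGoff : ∀ ξ ∉ Set.range emb, G ξ = 0 := fun ξ hξ => by
    rw [hG]
    simp only
    rw [if_neg]
    rintro ⟨r, hr⟩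
    exact hξ ⟨r, by rw [hemb]; simp only; rw [hr, mul_div_cancel_left₀ _ hd0]⟩
  have hGemb : G ∘ emb = fun r : 𝓞 K =>
      C * ‖mixedEmbedding K (r : K)‖⁻¹ ^ k + if r = 0 then ‖F 0‖ else 0 := by
    funext r
    rw [Function.comp_apply, hG]
    simp only [hdemb, hemb0]
    rw [if_pos ⟨r, rfl⟩]
    by_cases hr : r = 0
    · subst hr
      simp [zero_pow hk0]
    · rw [if_neg hr, if_neg hr, add_zero]
  have hGsum : Summable G := by
    rw [← hembi.summable_iff hGoff, hGemb]
    refine ((summable_norm_mixedEmbedding_inv_pow K hk).mul_left C).add ?_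
    refine summable_of_ne_finset_zero (s := {0}) fun r hr => ?_
    rw [Finset.mem_singleton] at hr
    rw [if_neg hr]
  exact Summable.of_nonneg_of_le (fun ξ => norm_nonneg _) hFG hGsum

end Literature.NumberTheory.Automorphic
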